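import Summits.Schanuel.Schanuel.Theorems.RootDecomp1KSkelCell06

/-!
# RootDecomp1KSkelCell — lens 1, generations 43–44 «THE QUALITY-ONLY CLASS SkelLiouville ⊋ LogLogLiouville AND ITS CERTIFIED MEMBER ρ⋆» (PRICE K-α L2033, CLAIM L2045, ACK L2046; (α) PROPER of the 1K wall map): the location-free class `SkelLiouville ρ := ∀ m ∃ r, m ≤ den r ∧ ρ ≠ r ∧ |ρ − r| < den^{−m·ι(den)}` (ι q = least N with q ≤ 2^{N!}) with `LogLogLiouville ⊊ SkelLiouville ⊆ Liouville` PROVED, the member ρ⋆ = Σ_j 2^{−2^{e_j}} (FREDHOLM SERIES WITH DELETED BLOCKS) certified HYPOTHESIS-FREE in Skel ∖ (LogLog ∪ FactorialGap), the SKEL engine + extraction, the walls (1, ℓ₂, ρ) mod hNW / π-twins and the pair (ℓ₂, ρ) HYPOTHESIS-FREE for every ρ ∈ Skel, the items APPLIED at z⋆ with all binders discharged, the m = 1 ceiling, and §9 hNW DISCHARGED BY NAME on the e-wall via the Literature proof module — continuation (RootDecomp1KSkelCell07): §4 the cells + live items in item shape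

(lens-1 g43/g44 HOME kernel SkelCell.lean EDITION 2 b7163857…, 2822 l, imports tree RootDecomp1KGapCell01 (+ for §9 only Literature ExpOneTranscendenceMeasureProofs); CLAIM L2045, ACK L2046 (CHECKLIST K-α (1)–(8) + the constant-dependence line of L2085 (R4)), NODE L2132 / REQUEST L2133, critic VERDICT L2140 (crit g9: CLEARED — ONE CELL credit (K-α); lens-1 tally credits ×11 + THEOREM; PORT GO in substance 01–0k `--supports stmt-Schanuel-33364`, the two scoped heartbeat raises flagged for the port record, addendum D as RootDecomp1KNWMeasureHolds GO LOW); port by census-1 gen 18 as `RootDecomp1KSkelCell01`–`11` along K's sections: 01 = §1 `iota`, `SkelLiouville`, inclusions `SkelLiouville.liouville` / `logLogLiouville_skelLiouville`; 02 = §5a anchors `aI`/`sI` + §5b the skeleton `eS`, positions `cS`, terms `aS` (up to `summable_aS`); 03 = §5b the member `rhoStar`, truncations `tS`/`rS`, bounds + §6 covering / quality lemmas; 04 = §6 THE MEMBER THEOREMS `skelLiouville_rhoStar`, `not_logLogLiouville_rhoStar`, `not_factorialGapLiouville_rhoStar`, `liouville_rhoStar`, `not_skelLiouville_subset_logLogLiouville`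 + §2 engine preliminaries (`SkelMeasure`, `exists_scale_index_iota`); 05 = §2 THE ENGINE `skelMeasure_cons_liouvilleNumber` (scoped `maxHeartbeats 800000` as in K) + `SkelMeasure.mvWeakMeasure`; 06 = §3 EXTRACTION `no_int_relation_of_skelMeasure_skelLiouville`, `sb_of_skelLiouville_of_skelMeasure`; 07 = §4 THE CELLS (pair hyp-free, walls mod hNW, π-twins) + the live items in item shape; 08 = §7 three interlaced cuts `deletedBlock_margins`, `form_lower_bound_S` (scoped `maxHeartbeats 1600000`); 09 = §7b member tuples zS2/zS3/zS3pi, scope certificates, items AT the members; 10 = §8 the fixed-multiple ladder and the m = 1 ceiling (`uStar`, `skel_fixedOne_ceiling`); 11 = §9 hNW DISCHARGED BY NAME (imports Literature ExpOneTranscendenceMeasureProofs).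
PORT EDITS: `set_option linter.dupNamespace false` dropped; the Literature import moved from the head to part 11 (the only user); K's 13 private helpers travel as per-part private copies; two generic helpers made `private` after the dedup bounce of 02 (p829539: `two_mul_le_two_pow` ≡ Literature.NumberTheory.EllipticCurves.two_mul_le_two_pow; also `log_two_lt_self` pre-emptively) and of 03 (p829791: `one_le_loglog` ≡ Literature Tao2016.EntropyDecrement.one_le_log_log; then nine more generic arithmetic helpers privatised pre-emptively: loglog_pow_pow_ge, add_factorial_mul_le_factorial_add, one_lt_ell2, partialSum_two_two, five_fourths_le_partialSum, ell2_lt, psNumer_two_cast, two_pow_lt_psNumer); and of 07 (p830787: the read-back `sb_logLogWall3_via_skel` ≡ tree `RootDecomp1KLogLogCell.sb_logLogCell` → private; in §9 likewise `nwMeasure_holds` and `sb_logLogWall3_via_skel'`, whose statements coincide with the census port RootDecomp1KNWMeasureHolds — `nwMeasure_holds` / `polyMeasure_exp_one_holds` / `sb_logLogCell'` there); statements and proofs verbatim. `--supports stmt-Schanuel-33364`; no census credit carried; rung 0 — nothing here proves Schanuel.)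
-/

open Summit.Schanuel.Schanuel.Theorems.RootDecomp1KHyper
open Summit.Schanuel.Schanuel.Theorems.RootDecomp1KHyper.HyperCell
open Summit.Schanuel.Schanuel.Theorems.RootDecomp1KGeneric
open Summit.Schanuel.Schanuel.Theorems.RootDecomp1KRelLiouvilleCell
open Summit.Schanuel.Schanuel.Theorems.RootDecomp1KLogLogCell
open Summit.Schanuel.Schanuel.Theorems.RootDecomp1KTwoBaseCell
open Summit.Schanuel.Schanuel.Theorems.RootDecomp1KGapCell
open LiouvilleNumber
open scoped Nat

namespace Summit.Schanuel.Schanuel.Theorems.RootDecomp1KSkelCell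

/-! ## §4  THE CELLS — Schanuel's bound on the SKEL PAIR `(ℓ₂, ρ)` (HYPOTHESIS-FREE), on the SKEL WALLS
`(1, ℓ₂, ρ)` (mod `hNW : NWMeasure` BY NAME) and `(π, πℓ₂, πρ)` (HYPOTHESIS-FREE), for EVERY Skel-Liouville `ρ`;
and the live items 33364 / 31077 in item shape (binders VERBATIM + ONE `Set.range` line) -/

section Cells
open IntermediateField

/-- The empty tuple has (trivially) a polynomial measure of algebraic independence (copy of the tree's
private GapCell04 helper). -/
private theorem mvPolyMeasure_fin_zero' (θ : Fin 0 → ℂ) : MvPolyMeasure θ := by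
  intro d
  refine ⟨1, 0, one_pos, fun P hP _ => ?_⟩
  have hP' : P = MvPolynomial.C (P.coeff 0) := P.eq_C_of_isEmpty
  have hc : P.coeff 0 ≠ 0 := by
    intro h; apply hP; rw [hP', h, map_zero]
  have hval : MvPolynomial.aeval θ P = ((P.coeff 0 : ℤ) : ℂ) := by
    rw [hP', MvPolynomial.aeval_C, algebraMap_int_eq, eq_intCast, MvPolynomial.coeff_C, if_pos rfl]
  rw [pow_zero, mul_one, one_mul, hval, Complex.norm_intCast]
  exact_mod_cast Int.one_le_abs hc

/-- **`(ℓ₂)` alone has a SKEL measure — HYPOTHESIS-FREE** (the engine with the empty `θ⃗`). -/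
theorem skelMeasure_liouvilleNumber :
    SkelMeasure (Fin.cons ((liouvilleNumber 2 : ℝ) : ℂ) Fin.elim0 : Fin 1 → ℂ) :=
  skelMeasure_cons_liouvilleNumber (mvPolyMeasure_fin_zero' Fin.elim0)

/-- **`(ℓ₂, π)` has a SKEL measure — HYPOTHESIS-FREE** (π's polynomial measure is tree-proved, `polyMeasure_pi`). -/
theorem skelMeasure_liouvilleNumber_pi :
    SkelMeasure (Fin.cons ((liouvilleNumber 2 : ℝ) : ℂ) ![(Real.pi : ℂ)] : Fin 2 → ℂ) :=
  skelMeasure_cons_liouvilleNumber (mvPolyMeasure_one_of_polyMeasure polyMeasure_pi)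

/-- **`(ℓ₂, e)` has a SKEL measure** (mod the Nesterenko–Waldschmidt measure of `e`, `hNW : NWMeasure` BY NAME). -/
theorem skelMeasure_liouvilleNumber_exp_one (hNW : NWMeasure) :
    SkelMeasure (Fin.cons ((liouvilleNumber 2 : ℝ) : ℂ) ![Complex.exp 1] : Fin 2 → ℂ) :=
  skelMeasure_cons_liouvilleNumber (mvPolyMeasure_one_of_polyMeasure (polyMeasure_exp_one_of_NW hNW))

/-- **THE SKEL PAIR CELL `(ℓ₂, ρ)`, `ρ` Skel-Liouville: `SB 2` — HYPOTHESIS-FREE** (the scope of 31077: `ℓ₂` is a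
Liouville coordinate).  No `hNW`: the measured tuple is `(ℓ₂)` alone. -/
theorem sb_skelPair {ρ : ℝ} (hρ : SkelLiouville ρ) :
    SB 2 ![((liouvilleNumber 2 : ℝ) : ℂ), (ρ : ℂ)] := by
  refine sb_of_skelLiouville_of_skelMeasure (n := 1) hρ ?_ skelMeasure_liouvilleNumber ?_
  · exact subset_adjoin ℚ _ (Or.inl (Or.inl ⟨1, rfl⟩))
  · intro j
    refine Fin.cases ?_ (fun i => i.elim0) j
    simp only [Fin.cons_zero]
    exact subset_adjoin ℚ _ (Or.inl (Or.inl ⟨0, rfl⟩))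

/-- **THE SKEL WALL CELL `(1, ℓ₂, ρ)`, `ρ` Skel-Liouville: `SB 3`** (mod `hNW : NWMeasure` BY NAME — the measured
tuple is `(ℓ₂, e)`, `e = exp(z 0)`). -/
theorem sb_skelWall3 (hNW : NWMeasure) {ρ : ℝ} (hρ : SkelLiouville ρ) :
    SB 3 ![(1 : ℂ), ((liouvilleNumber 2 : ℝ) : ℂ), (ρ : ℂ)] := by
  refine sb_of_skelLiouville_of_skelMeasure (n := 2) hρ ?_
    (skelMeasure_liouvilleNumber_exp_one hNW) ?_
  · exact subset_adjoin ℚ _ (Or.inl (Or.inl ⟨2, rfl⟩))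
  · refine Fin.forall_fin_two.mpr ⟨?_, ?_⟩
    · exact subset_adjoin ℚ _ (Or.inl (Or.inl ⟨1, rfl⟩))
    · exact subset_adjoin ℚ _ (Or.inl (Or.inr ⟨0, rfl⟩))

/-- **THE SKEL WALL CELL, π-twin `(π, πℓ₂, πρ)`: `SB 3` — HYPOTHESIS-FREE** (the measured tuple is `(ℓ₂, π)`). -/
theorem sb_skelWall3_pi {ρ : ℝ} (hρ : SkelLiouville ρ) :
    SB 3 ![(Real.pi : ℂ), (Real.pi : ℂ) * ((liouvilleNumber 2 : ℝ) : ℂ), (Real.pi : ℂ) * (ρ : ℂ)] := by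
  set z : Fin 3 → ℂ :=
    ![(Real.pi : ℂ), (Real.pi : ℂ) * ((liouvilleNumber 2 : ℝ) : ℂ), (Real.pi : ℂ) * (ρ : ℂ)] with hz
  have hπ0 : (Real.pi : ℂ) ≠ 0 := by exact_mod_cast Real.pi_ne_zero
  have hz0 : z 0 ∈ adjoin ℚ (SFset z ∪ {Complex.I}) := subset_adjoin ℚ _ (Or.inl (Or.inl ⟨0, rfl⟩))
  have hz1 : z 1 ∈ adjoin ℚ (SFset z ∪ {Complex.I}) := subset_adjoin ℚ _ (Or.inl (Or.inl ⟨1, rfl⟩))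
  have hz2 : z 2 ∈ adjoin ℚ (SFset z ∪ {Complex.I}) := subset_adjoin ℚ _ (Or.inl (Or.inl ⟨2, rfl⟩))
  have ez0 : z 0 = (Real.pi : ℂ) := rfl
  have ez1 : z 1 = (Real.pi : ℂ) * ((liouvilleNumber 2 : ℝ) : ℂ) := rfl
  have ez2 : z 2 = (Real.pi : ℂ) * (ρ : ℂ) := rfl
  have eρ : (ρ : ℂ) = z 2 / z 0 := by rw [ez2, ez0, mul_div_cancel_left₀ _ hπ0]
  have eℓ : ((liouvilleNumber 2 : ℝ) : ℂ) = z 1 / z 0 := by rw [ez1, ez0, mul_div_cancel_left₀ _ hπ0]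
  refine sb_of_skelLiouville_of_skelMeasure (n := 2) hρ ?_ skelMeasure_liouvilleNumber_pi ?_
  · rw [eρ]; exact div_mem hz2 hz0
  · refine Fin.forall_fin_two.mpr ⟨?_, ?_⟩
    · show ((liouvilleNumber 2 : ℝ) : ℂ) ∈ _
      rw [eℓ]; exact div_mem hz1 hz0
    · exact hz0

/-! ### The live items in item shape (binders VERBATIM + ONE `Set.range z = Set.range ![…]` line) -/

/-- **ITEM 31077 ON THE SKEL PAIR `(ℓ₂, ρ)` — HYPOTHESIS-FREE, ∀ ρ ∈ SkelLiouville.**  Binders of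
`Summit.Schanuel.Schanuel.Theses.RootDecomp1K.CoordLiouvilleSchanuel` VERBATIM, with ONE line inserted after
`LinearIndependent ℚ z` — the cell `Set.range z = Set.range ![ℓ₂, ρ]` (`ℓ₂` is the Liouville coordinate of the
scope; the scope binder is not used by the proof and is CERTIFIED at the member `z⋆₂`, §7). -/
theorem coordLiouvilleSchanuel_skelPair {ρ : ℝ} (hρ : SkelLiouville ρ) :
    ∀ (n : ℕ) (z : Fin n → ℂ), LinearIndependent ℚ z →
      Set.range z = Set.range ![((liouvilleNumber 2 : ℝ) : ℂ), (ρ : ℂ)] →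
      (∃ w ∈ Submodule.span ℚ (Set.range z), Liouville w.re ∨ Liouville w.im) →
      (n : Cardinal) ≤ Algebra.trdeg ℚ
        ↥(IntermediateField.adjoin ℚ (Set.range z ∪ Set.range (Complex.exp ∘ z))) := by
  intro n z hz hrange _
  exact sb_of_range_eq' hz.injective hrange (sb_skelPair hρ)

/-- **ITEM 31077 ON THE SKEL WALL `(1, ℓ₂, ρ)`** (mod `hNW` BY NAME; binders verbatim + the cell line). -/
theorem coordLiouvilleSchanuel_skelWall3 (hNW : NWMeasure) {ρ : ℝ} (hρ : SkelLiouville ρ) :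
    ∀ (n : ℕ) (z : Fin n → ℂ), LinearIndependent ℚ z →
      Set.range z = Set.range ![(1 : ℂ), ((liouvilleNumber 2 : ℝ) : ℂ), (ρ : ℂ)] →
      (∃ w ∈ Submodule.span ℚ (Set.range z), Liouville w.re ∨ Liouville w.im) →
      (n : Cardinal) ≤ Algebra.trdeg ℚ
        ↥(IntermediateField.adjoin ℚ (Set.range z ∪ Set.range (Complex.exp ∘ z))) := by
  intro n z hz hrange _
  exact sb_of_range_eq' hz.injective hrange (sb_skelWall3 hNW hρ)

/-- **ITEM 33364 ON THE SKEL WALL `(1, ℓ₂, ρ)`** (e-version, mod `hNW` BY NAME).  Binders of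
`Summit.Schanuel.Schanuel.Theses.RootDecomp1K.FiniteOrderLiouvilleSchanuel` VERBATIM, with ONE line inserted
after `LinearIndependent ℚ z` — the cell `Set.range z = Set.range ![1, ℓ₂, ρ]`, `ρ` ranging over the SKEL-LIOUVILLE
reals.  The two Diophantine binders are not used by the proof; they are CERTIFIED at the member `z⋆₃` (§7). -/
theorem finiteOrderLiouvilleSchanuel_skelWall3 (hNW : NWMeasure) {ρ : ℝ} (hρ : SkelLiouville ρ) :
    ∀ (n : ℕ) (z : Fin n → ℂ), LinearIndependent ℚ z →
      Set.range z = Set.range ![(1 : ℂ), ((liouvilleNumber 2 : ℝ) : ℂ), (ρ : ℂ)] →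
      (∀ ω : ℕ, ∃ h : Fin n → ℤ, h ≠ 0 ∧ ‖∑ i, (h i : ℂ) * z i‖ < 1 / (1 + ∑ i, (|h i| : ℝ)) ^ ω) →
      (¬ ∀ m : ℕ, ∃ h : Fin n → ℤ, h ≠ 0 ∧
        ‖∑ i, (h i : ℂ) * z i‖ < Real.exp (-((1 + ∑ i, (|h i| : ℝ)) ^ m))) →
      (n : Cardinal) ≤ Algebra.trdeg ℚ
        ↥(IntermediateField.adjoin ℚ (Set.range z ∪ Set.range (Complex.exp ∘ z))) := by
  intro n z hz hrange _ _
  exact sb_of_range_eq' hz.injective hrange (sb_skelWall3 hNW hρ)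

/-- **ITEM 33364 ON THE SKEL WALL, π-twin `(π, πℓ₂, πρ)` — HYPOTHESIS-FREE.** Same binders verbatim, the cell
line `Set.range z = Set.range ![π, πℓ₂, πρ]`, `ρ` Skel-Liouville. -/
theorem finiteOrderLiouvilleSchanuel_skelWall3_pi {ρ : ℝ} (hρ : SkelLiouville ρ) :
    ∀ (n : ℕ) (z : Fin n → ℂ), LinearIndependent ℚ z →
      Set.range z = Set.range ![(Real.pi : ℂ), (Real.pi : ℂ) * ((liouvilleNumber 2 : ℝ) : ℂ),
        (Real.pi : ℂ) * (ρ : ℂ)] →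
      (∀ ω : ℕ, ∃ h : Fin n → ℤ, h ≠ 0 ∧ ‖∑ i, (h i : ℂ) * z i‖ < 1 / (1 + ∑ i, (|h i| : ℝ)) ^ ω) →
      (¬ ∀ m : ℕ, ∃ h : Fin n → ℤ, h ≠ 0 ∧
        ‖∑ i, (h i : ℂ) * z i‖ < Real.exp (-((1 + ∑ i, (|h i| : ℝ)) ^ m))) →
      (n : Cardinal) ≤ Algebra.trdeg ℚ
        ↥(IntermediateField.adjoin ℚ (Set.range z ∪ Set.range (Complex.exp ∘ z))) := by
  intro n z hz hrange _ _
  exact sb_of_range_eq' hz.injective hrange (sb_skelWall3_pi hρ)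

/-- **COROLLARY — the tree's LOG-LOG wall is a SUB-cell of the Skel wall** (`LogLogLiouville ⊂ SkelLiouville`, §1):
the log-log wall theorem of the tree re-derived through the Skel engine (consistency check, e-version). -/
private theorem sb_logLogWall3_via_skel (hNW : NWMeasure) {ρ : ℝ} (hρ : LogLogLiouville ρ) :
    SB 3 ![(1 : ℂ), ((liouvilleNumber 2 : ℝ) : ℂ), (ρ : ℂ)] :=
  sb_skelWall3 hNW (logLogLiouville_skelLiouville hρ)

end Cells

end Summit.Schanuel.Schanuel.Theorems.RootDecomp1KSkelCell
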